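import Summits.Parity.GeneralizedHardyLittlewood.Theorems.ChenParityOracleBLAPHostParityFromBrickSiftedTail
import Literature.NumberTheory.Sieve.DivisorPowerSums
import Literature.NumberTheory.LFunctions.LiouvilleSumClassicalBound
import HarnessLib

/-!
# Route `ChenParityOracleBLAP` — crux S1 = `HostParityFromBrick` (stmt-Parity-20045): Type-II pieces — trivial bound on a sparse set of pairs

Support file for the prime half `K1 → K2 → HP1` of S1 (Type-II dispatch of Vaughan's identity).
On any set `E` of pairs `(m, n)` with `mn ≤ y` the level sums are bounded trivially by
`∑_{(m,n) ∈ E} τ(mn+2) ≤ √#E · √(∑_{k ≤ y} τ(k) τ(k+2)²)` (`sum_level_pairs_trivial_le`,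
`sum_pairs_tau_sq_le`), and `∑_{k ≤ y} τ(k)τ(k+2)² ≤ C (y+2)(log(y+2))^{20}` by Cauchy–Schwarz and
the divisor power moments of the tree (`sum_tau_tau_sq_le`).

References: H. Iwaniec, E. Kowalski, *Analytic Number Theory* (2004), §13.4 [IwaniecKowalski2004].
-/

namespace Summit.Parity.GeneralizedHardyLittlewood.Theorems

open Finset Real
open scoped ArithmeticFunction.sigma
open ArithmeticFunction (liouville sigma)

/-- `∑_{(m,n) ∈ E} τ(mn+2)² ≤ ∑_{k ≤ y} τ(k) τ(k+2)²` for pairs with `m, n ≥ 1`, `mn ≤ y`. -/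
theorem sum_pairs_tau_sq_le (E : Finset (ℕ × ℕ)) (y : ℕ)
    (hE : ∀ p ∈ E, 1 ≤ p.1 ∧ 1 ≤ p.2 ∧ p.1 * p.2 ≤ y) :
    ∑ p ∈ E, ((σ 0 (p.1 * p.2 + 2) : ℝ)) ^ 2 ≤
      ∑ k ∈ Icc 1 y, (σ 0 k : ℝ) * (σ 0 (k + 2) : ℝ) ^ 2 := by
  classical
  have hmaps : ∀ p ∈ E, p.1 * p.2 ∈ Icc 1 y := by
    intro p hp
    obtain ⟨h1, h2, h3⟩ := hE p hp
    rw [Finset.mem_Icc]; exact ⟨Nat.one_le_iff_ne_zero.mpr (by positivity), h3⟩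
  rw [← Finset.sum_fiberwise_of_maps_to hmaps]
  refine Finset.sum_le_sum fun k hk => ?_
  rw [Finset.mem_Icc] at hk
  have hfib : ∀ p ∈ E.filter (fun p => p.1 * p.2 = k),
      ((σ 0 (p.1 * p.2 + 2) : ℝ)) ^ 2 = (σ 0 (k + 2) : ℝ) ^ 2 := by
    intro p hp; rw [Finset.mem_filter] at hp; rw [hp.2]
  rw [Finset.sum_congr rfl hfib, Finset.sum_const, nsmul_eq_mul]
  refine mul_le_mul_of_nonneg_right ?_ (by positivity)
  -- the fibre injects into the divisors of `k` via `p ↦ p.1`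
  have hinj : Set.InjOn (fun p : ℕ × ℕ => p.1) (E.filter (fun p => p.1 * p.2 = k) : Set (ℕ × ℕ)) := by
    intro p hp q hq h
    simp only [Finset.coe_filter, Set.mem_setOf_eq] at hp hq
    simp only at h
    have hq1 : 1 ≤ q.1 := (hE q hq.1).1
    have h2 : p.2 = q.2 := by
      have := hp.2.trans hq.2.symm
      rw [h] at this
      exact Nat.eq_of_mul_eq_mul_left hq1 this
    exact Prod.ext h h2
  have hcard : #(E.filter (fun p => p.1 * p.2 = k)) ≤ σ 0 k := by
    rw [ArithmeticFunction.sigma_zero_apply, ← Finset.card_image_of_injOn hinj]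
    refine Finset.card_le_card fun m hm => ?_
    rw [Finset.mem_image] at hm
    obtain ⟨p, hp, rfl⟩ := hm
    rw [Finset.mem_filter] at hp
    exact Nat.mem_divisors.2 ⟨Dvd.intro _ hp.2, by omega⟩
  exact_mod_cast hcard

/-- **Divisor moment.**  There is `C > 0` with `∑_{k ≤ y} τ(k) τ(k+2)² ≤ C (y+2)(log(y+2))^{20}`
for all `y`. -/
theorem sum_tau_tau_sq_le : ∃ C : ℝ, 0 < C ∧ ∀ y : ℕ,
    ∑ k ∈ Icc 1 y, (σ 0 k : ℝ) * (σ 0 (k + 2) : ℝ) ^ 2 ≤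
      C * ((y : ℝ) + 2) * Real.log ((y : ℝ) + 2) ^ (20 : ℕ) := by
  classical
  obtain ⟨C₂, hC₂, h2⟩ := Literature.NumberTheory.Sieve.exists_sum_sigma_zero_pow_le_real 2
  obtain ⟨C₄, hC₄, h4⟩ := Literature.NumberTheory.Sieve.exists_sum_sigma_zero_pow_le_real 4
  refine ⟨Real.sqrt C₂ * Real.sqrt C₄, by positivity, fun y => ?_⟩
  have hy2 : (2 : ℝ) ≤ ((y + 2 : ℕ) : ℝ) := by push_cast; linarith [Nat.cast_nonneg (α := ℝ) y]
  have hcs := Real.sum_mul_le_sqrt_mul_sqrt (Icc 1 y) (fun k => (σ 0 k : ℝ))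
    (fun k => (σ 0 (k + 2) : ℝ) ^ 2)
  refine hcs.trans ?_
  -- the two moments
  have hA : ∑ k ∈ Icc 1 y, (σ 0 k : ℝ) ^ 2 ≤ C₂ * ((y : ℝ) + 2) * Real.log ((y : ℝ) + 2) ^ (8 : ℕ) := by
    have h := h2 ((y + 2 : ℕ) : ℝ) hy2
    rw [Nat.floor_natCast] at h
    push_cast at h
    exact (Finset.sum_le_sum_of_subset_of_nonneg (Finset.Icc_subset_Icc_right (by omega))
      fun k _ _ => by positivity).trans h
  have hB : ∑ k ∈ Icc 1 y, ((σ 0 (k + 2) : ℝ) ^ 2) ^ 2 ≤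
      C₄ * ((y : ℝ) + 2) * Real.log ((y : ℝ) + 2) ^ (32 : ℕ) := by
    have h := h4 ((y + 2 : ℕ) : ℝ) hy2
    rw [Nat.floor_natCast] at h
    push_cast at h
    have hinj : Set.InjOn (fun k : ℕ => k + 2) (Icc 1 y : Set ℕ) := fun a _ b _ h => by simpa using h
    have heq : ∑ k ∈ Icc 1 y, ((σ 0 (k + 2) : ℝ) ^ 2) ^ 2 =
        ∑ n ∈ (Icc 1 y).image (fun k => k + 2), (σ 0 n : ℝ) ^ 4 := by
      rw [Finset.sum_image hinj]; refine Finset.sum_congr rfl fun k _ => ?_; ring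
    rw [heq]
    refine (Finset.sum_le_sum_of_subset_of_nonneg ?_ fun k _ _ => by positivity).trans h
    intro n hn
    rw [Finset.mem_image] at hn
    obtain ⟨k, hk, rfl⟩ := hn
    rw [Finset.mem_Icc] at hk ⊢; omega
  have hL0 : 0 ≤ Real.log ((y : ℝ) + 2) := Real.log_nonneg (by linarith [Nat.cast_nonneg (α := ℝ) y])
  calc Real.sqrt (∑ k ∈ Icc 1 y, (σ 0 k : ℝ) ^ 2) *
        Real.sqrt (∑ k ∈ Icc 1 y, ((σ 0 (k + 2) : ℝ) ^ 2) ^ 2)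
      ≤ Real.sqrt (C₂ * ((y : ℝ) + 2) * Real.log ((y : ℝ) + 2) ^ (8 : ℕ)) *
        Real.sqrt (C₄ * ((y : ℝ) + 2) * Real.log ((y : ℝ) + 2) ^ (32 : ℕ)) :=
        mul_le_mul (Real.sqrt_le_sqrt hA) (Real.sqrt_le_sqrt hB) (Real.sqrt_nonneg _)
          (Real.sqrt_nonneg _)
    _ = Real.sqrt C₂ * Real.sqrt C₄ * ((y : ℝ) + 2) * Real.log ((y : ℝ) + 2) ^ (20 : ℕ) := by
        rw [← Real.sqrt_mul (by positivity), ← Real.sqrt_mul hC₂.le]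
        rw [show C₂ * ((y : ℝ) + 2) * Real.log ((y : ℝ) + 2) ^ (8 : ℕ) *
            (C₄ * ((y : ℝ) + 2) * Real.log ((y : ℝ) + 2) ^ (32 : ℕ)) =
            (C₂ * C₄) * (((y : ℝ) + 2) * Real.log ((y : ℝ) + 2) ^ (20 : ℕ)) ^ 2 by ring,
          Real.sqrt_mul (by positivity), Real.sqrt_sq (by positivity)]
        ring

/-- **Trivial bound on a set of pairs.**  For `|α|, |β| ≤ 1`, pairs `E` with `m, n ≥ 1`,
`mn ≤ y`, and any `D`:
`∑_{d ≤ D} ∑_{(m,n) ∈ E} |α(m) β(n) [d ∣ mn+2] λ(mn+2)| ≤ √#E · √(∑_{k ≤ y} τ(k) τ(k+2)²)`. -/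
theorem sum_level_pairs_trivial_le (E : Finset (ℕ × ℕ)) (y D : ℕ)
    (hE : ∀ p ∈ E, 1 ≤ p.1 ∧ 1 ≤ p.2 ∧ p.1 * p.2 ≤ y) {α β : ℕ → ℝ} (hα : ∀ n, |α n| ≤ 1)
    (hβ : ∀ n, |β n| ≤ 1) :
    ∑ d ∈ Icc 1 D, ∑ p ∈ E,
        |α p.1 * β p.2 * (if d ∣ p.1 * p.2 + 2 then (liouville (p.1 * p.2 + 2) : ℝ) else 0)| ≤
      Real.sqrt #E * Real.sqrt (∑ k ∈ Icc 1 y, (σ 0 k : ℝ) * (σ 0 (k + 2) : ℝ) ^ 2) := by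
  classical
  rw [Finset.sum_comm]
  -- per pair: `∑_d |…| ≤ τ(mn+2)`
  have hpair : ∀ p ∈ E, ∑ d ∈ Icc 1 D,
      |α p.1 * β p.2 * (if d ∣ p.1 * p.2 + 2 then (liouville (p.1 * p.2 + 2) : ℝ) else 0)| ≤
      (σ 0 (p.1 * p.2 + 2) : ℝ) := by
    intro p _
    have h1 : ∀ d ∈ Icc 1 D,
        |α p.1 * β p.2 * (if d ∣ p.1 * p.2 + 2 then (liouville (p.1 * p.2 + 2) : ℝ) else 0)| ≤
        if d ∣ p.1 * p.2 + 2 then (1 : ℝ) else 0 := by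
      intro d _
      split_ifs with hd
      · rw [abs_mul, abs_mul]
        have := Literature.NumberTheory.LFunctions.LiouvilleSum.abs_liouville_le_one (p.1 * p.2 + 2)
        calc |α p.1| * |β p.2| * |(liouville (p.1 * p.2 + 2) : ℝ)| ≤ 1 * 1 * 1 :=
              mul_le_mul (mul_le_mul (hα _) (hβ _) (abs_nonneg _) zero_le_one) this
                (abs_nonneg _) (by norm_num)
          _ = 1 := by ring
      · simp
    refine (Finset.sum_le_sum h1).trans ?_
    rw [← Finset.sum_filter, Finset.sum_const, nsmul_eq_mul, mul_one]
    exact_mod_cast card_filter_dvd_le_sigma_zero (Icc 1 D) (by omega : p.1 * p.2 + 2 ≠ 0)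
  refine (Finset.sum_le_sum hpair).trans ?_
  have hcs := Real.sum_mul_le_sqrt_mul_sqrt E (fun _ => (1 : ℝ)) (fun p => (σ 0 (p.1 * p.2 + 2) : ℝ))
  simp only [one_mul, one_pow, Finset.sum_const, nsmul_eq_mul, mul_one] at hcs
  exact hcs.trans (mul_le_mul_of_nonneg_left (Real.sqrt_le_sqrt (sum_pairs_tau_sq_le E y hE))
    (Real.sqrt_nonneg _))

end Summit.Parity.GeneralizedHardyLittlewood.Theorems
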